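import Mathlib
import HarnessLib
import Literature.Probability.Process.RootedHardCoreVague
import Summits.AtomisticToContinuum.Crystallization.Theorems.PalmUnimodularRigidityBenjaminiSchrammLimitCampbell

/-!
# Ergodic reduction for the crux `AperiodicFrustratedLawGap` — the re-rooting involution and mass transport

Route `FrustratedLawDichotomy`, crux `AperiodicFrustratedLawGap` (item `stmt-AtomisticToContinuum-27623`),
registered stub `stub_ergodicReduction` (skeleton `dd3251ad731e`); first brick of step D5 (a.e. ergodicity of
the conditional laws, the one open input `hErg` of `…ErgodicAssembly.ergodicReduction_of_aeErgodic`) along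
the route recorded in the item's census: the MEAN ERGODIC THEOREM for the lazy symmetric re-rooting Markov
operator `(P f)(S) = Σ_{y ∈ S} w(y) f(S - y)`.  Its self-adjointness in `L²(ν)` for every Campbell-invariant
law `ν` is the mass-transport principle; here in `lintegral` form:

* `neg_mem_reroot`, `reroot_reroot_neg`, `reroot_reroot_apply` — re-rooting at `y ∈ S` and then at the old
  root `-y ∈ S - y` returns `S`: the re-rooting map `Θ (S, y) = (S - y, -y)` is an involution on the
  incidence set `{(S, y) | y ∈ S}`;
* `ae_snd_mem_compProd` — the incidence set carries the Campbell measure `ν ⊗ₘ κ₀` of every law `ν`;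
* `lintegral_mul_lintegral_reroot_comm` — **mass transport / symmetry**: for a Campbell-invariant `ν`, a
  measurable even weight `w` and measurable `f, g ≥ 0`,
  `∫ g(S) Σ_{y∈S} w(y) f(S-y) dν = ∫ f(S) Σ_{y∈S} w(y) g(S-y) dν`.

`[folklore]` (Aldous–Lyons 2007 §2 mass-transport principle; Last–Thorisson 2009).
-/

noncomputable section

namespace Summit.AtomisticToContinuum.Crystallization.Theorems.FrustratedLawDichotomyErgodicReduction

open MeasureTheory Set Filter ProbabilityTheory
open scoped ENNReal Classical
open Literature.Probability.Process (LocalConfig)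
open Literature.Probability.Process.LocalConfig (RootedHardCoreConfig toMeasure_def measurable_toMeasure)
open Summit.AtomisticToContinuum.Crystallization.Theorems.BenjaminiSchrammLimit (isSFiniteKernel_toMeasure
  measurable_reroot isClosed_incidence)

variable {δ : ℝ}

/-! ### The re-rooting involution -/

/-- The old root, seen from the new one: `-y ∈ S - y` for `y ∈ S` (as `0 ∈ S`). [folklore] -/
theorem neg_mem_reroot (S : RootedHardCoreConfig (EuclideanSpace ℝ (Fin 3)) δ) (y : EuclideanSpace ℝ (Fin 3))
    (hy : y ∈ ((S.1 : LocalConfig (EuclideanSpace ℝ (Fin 3))) : Set (EuclideanSpace ℝ (Fin 3)))) :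
    -y ∈ (((S.reroot y hy).1 : LocalConfig (EuclideanSpace ℝ (Fin 3))) : Set (EuclideanSpace ℝ (Fin 3))) := by
  rw [RootedHardCoreConfig.coe_reroot]
  exact ⟨0, S.2.1, zero_sub y⟩

/-- **Re-rooting twice returns the configuration**: `(S - y) - (-y) = S`. [folklore] -/
theorem reroot_reroot_neg (S : RootedHardCoreConfig (EuclideanSpace ℝ (Fin 3)) δ)
    (y : EuclideanSpace ℝ (Fin 3))
    (hy : y ∈ ((S.1 : LocalConfig (EuclideanSpace ℝ (Fin 3))) : Set (EuclideanSpace ℝ (Fin 3))))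
    (h : -y ∈ (((S.reroot y hy).1 : LocalConfig (EuclideanSpace ℝ (Fin 3))) : Set (EuclideanSpace ℝ (Fin 3)))) :
    (S.reroot y hy).reroot (-y) h = S := by
  apply Subtype.ext
  show ((S.1 : LocalConfig (EuclideanSpace ℝ (Fin 3))).translate y).translate (-y) = S.1
  rw [LocalConfig.translate_translate, neg_add_cancel, LocalConfig.translate_zero]

/-- **The re-rooting map is an involution on the incidence set**: `Θ (Θ (S, y)) = (S, y)` for `y ∈ S`,
`Θ (S, y) = (S - y, -y)` (junk value `(S, -y)` off the incidence set). [folklore] -/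
theorem reroot_reroot_apply (p : RootedHardCoreConfig (EuclideanSpace ℝ (Fin 3)) δ × EuclideanSpace ℝ (Fin 3))
    (hp : p.2 ∈ ((p.1.1 : LocalConfig (EuclideanSpace ℝ (Fin 3))) : Set (EuclideanSpace ℝ (Fin 3)))) :
    (fun p : RootedHardCoreConfig (EuclideanSpace ℝ (Fin 3)) δ × EuclideanSpace ℝ (Fin 3) =>
        ((if h : p.2 ∈ ((p.1.1 : LocalConfig (EuclideanSpace ℝ (Fin 3))) : Set (EuclideanSpace ℝ (Fin 3)))
          then p.1.reroot p.2 h else p.1 : RootedHardCoreConfig (EuclideanSpace ℝ (Fin 3)) δ), -p.2))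
      ((fun p : RootedHardCoreConfig (EuclideanSpace ℝ (Fin 3)) δ × EuclideanSpace ℝ (Fin 3) =>
        ((if h : p.2 ∈ ((p.1.1 : LocalConfig (EuclideanSpace ℝ (Fin 3))) : Set (EuclideanSpace ℝ (Fin 3)))
          then p.1.reroot p.2 h else p.1 : RootedHardCoreConfig (EuclideanSpace ℝ (Fin 3)) δ), -p.2)) p) = p := by
  obtain ⟨S, y⟩ := p
  have hy : y ∈ ((S.1 : LocalConfig (EuclideanSpace ℝ (Fin 3))) : Set (EuclideanSpace ℝ (Fin 3))) := hp
  have hny := neg_mem_reroot S y hy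
  simp only [dif_pos hy, neg_neg, Prod.mk.injEq, and_true]
  rw [dif_pos hny]
  exact reroot_reroot_neg S y hy hny

/-! ### The incidence set carries every Campbell measure -/

/-- **Campbell measures live on the incidence set**: for every s-finite law `ν` on rooted `δ`-hard-core
configurations (`δ > 0`), `ν ⊗ₘ κ₀`-almost every pair `(S, y)` has `y ∈ S` (`κ₀ S = count|S` is carried by
the closed set `S`). [folklore] -/
theorem ae_snd_mem_compProd [Fact (0 < δ)]
    (ν : Measure (RootedHardCoreConfig (EuclideanSpace ℝ (Fin 3)) δ)) [SFinite ν] :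
    ∀ᵐ p ∂(haveI := isSFiniteKernel_toMeasure (E := EuclideanSpace ℝ (Fin 3)) (δ := δ)
      ν ⊗ₘ (⟨fun S : RootedHardCoreConfig (EuclideanSpace ℝ (Fin 3)) δ =>
        (S.1 : LocalConfig (EuclideanSpace ℝ (Fin 3))).toMeasure,
        measurable_toMeasure (Fact.out : 0 < δ)⟩ :
        Kernel (RootedHardCoreConfig (EuclideanSpace ℝ (Fin 3)) δ) (EuclideanSpace ℝ (Fin 3)))),
      p.2 ∈ ((p.1.1 : LocalConfig (EuclideanSpace ℝ (Fin 3))) : Set (EuclideanSpace ℝ (Fin 3))) := by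
  haveI := isSFiniteKernel_toMeasure (E := EuclideanSpace ℝ (Fin 3)) (δ := δ)
  have hδ : 0 < δ := Fact.out
  refine Measure.ae_compProd_of_ae_ae (isClosed_incidence hδ).measurableSet
    (Eventually.of_forall fun S => ?_)
  show ∀ᵐ y ∂((S.1 : LocalConfig (EuclideanSpace ℝ (Fin 3))).toMeasure),
    y ∈ ((S.1 : LocalConfig (EuclideanSpace ℝ (Fin 3))) : Set (EuclideanSpace ℝ (Fin 3)))
  rw [toMeasure_def]
  exact ae_restrict_mem (RootedHardCoreConfig.isClosed_coe hδ S).measurableSet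

/-! ### Mass transport: symmetry of the weighted re-rooting operator -/

/-- **Mass-transport symmetry of the weighted re-rooting operator.**  Let `ν` be a law on rooted `δ`-hard-core
configurations of `ℝ³` (`δ > 0`) whose Campbell measure `ν ⊗ₘ κ₀` is invariant under the re-rooting
involution `Θ`, let `w ≥ 0` be a measurable EVEN weight on `ℝ³` and `f, g ≥ 0` measurable functions of the
configuration.  Then
`∫ g(S) · (Σ_{y ∈ S} w(y) f(S - y)) dν(S) = ∫ f(S) · (Σ_{y ∈ S} w(y) g(S - y)) dν(S)`:
the operator `f ↦ Σ_{y ∈ S} w(y) f(S - y)` is symmetric in `L²(ν)` — the mass-transport principle for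
point-stationary laws (write both sides as Campbell integrals and substitute `Θ`, an a.e. involution).
[folklore] -/
theorem lintegral_mul_lintegral_reroot_comm [Fact (0 < δ)]
    {ν : Measure (RootedHardCoreConfig (EuclideanSpace ℝ (Fin 3)) δ)} [SFinite ν]
    (hinv : haveI := isSFiniteKernel_toMeasure (E := EuclideanSpace ℝ (Fin 3)) (δ := δ)
      (ν ⊗ₘ (⟨fun S : RootedHardCoreConfig (EuclideanSpace ℝ (Fin 3)) δ =>
        (S.1 : LocalConfig (EuclideanSpace ℝ (Fin 3))).toMeasure,
        measurable_toMeasure (Fact.out : 0 < δ)⟩ :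
        Kernel (RootedHardCoreConfig (EuclideanSpace ℝ (Fin 3)) δ) (EuclideanSpace ℝ (Fin 3)))).map
      (fun p : RootedHardCoreConfig (EuclideanSpace ℝ (Fin 3)) δ × EuclideanSpace ℝ (Fin 3) =>
        ((if h : p.2 ∈ ((p.1.1 : LocalConfig (EuclideanSpace ℝ (Fin 3))) : Set (EuclideanSpace ℝ (Fin 3)))
          then p.1.reroot p.2 h else p.1 : RootedHardCoreConfig (EuclideanSpace ℝ (Fin 3)) δ), -p.2)) =
      ν ⊗ₘ (⟨fun S : RootedHardCoreConfig (EuclideanSpace ℝ (Fin 3)) δ =>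
        (S.1 : LocalConfig (EuclideanSpace ℝ (Fin 3))).toMeasure,
        measurable_toMeasure (Fact.out : 0 < δ)⟩ :
        Kernel (RootedHardCoreConfig (EuclideanSpace ℝ (Fin 3)) δ) (EuclideanSpace ℝ (Fin 3))))
    {w : EuclideanSpace ℝ (Fin 3) → ℝ≥0∞} (hw : Measurable w) (hws : ∀ y, w (-y) = w y)
    {f g : RootedHardCoreConfig (EuclideanSpace ℝ (Fin 3)) δ → ℝ≥0∞} (hf : Measurable f) (hg : Measurable g) :
    ∫⁻ S, g S * ∫⁻ y, w y *
        f ((fun p : RootedHardCoreConfig (EuclideanSpace ℝ (Fin 3)) δ × EuclideanSpace ℝ (Fin 3) =>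
          ((if h : p.2 ∈ ((p.1.1 : LocalConfig (EuclideanSpace ℝ (Fin 3))) : Set (EuclideanSpace ℝ (Fin 3)))
            then p.1.reroot p.2 h else p.1 : RootedHardCoreConfig (EuclideanSpace ℝ (Fin 3)) δ), -p.2)) (S, y)).1
        ∂((S.1 : LocalConfig (EuclideanSpace ℝ (Fin 3))).toMeasure) ∂ν =
    ∫⁻ S, f S * ∫⁻ y, w y *
        g ((fun p : RootedHardCoreConfig (EuclideanSpace ℝ (Fin 3)) δ × EuclideanSpace ℝ (Fin 3) =>
          ((if h : p.2 ∈ ((p.1.1 : LocalConfig (EuclideanSpace ℝ (Fin 3))) : Set (EuclideanSpace ℝ (Fin 3)))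
            then p.1.reroot p.2 h else p.1 : RootedHardCoreConfig (EuclideanSpace ℝ (Fin 3)) δ), -p.2)) (S, y)).1
        ∂((S.1 : LocalConfig (EuclideanSpace ℝ (Fin 3))).toMeasure) ∂ν := by
  haveI := isSFiniteKernel_toMeasure (E := EuclideanSpace ℝ (Fin 3)) (δ := δ)
  have hδ : 0 < δ := Fact.out
  have hΘ : Measurable (fun p : RootedHardCoreConfig (EuclideanSpace ℝ (Fin 3)) δ × EuclideanSpace ℝ (Fin 3) =>
      ((if h : p.2 ∈ ((p.1.1 : LocalConfig (EuclideanSpace ℝ (Fin 3))) : Set (EuclideanSpace ℝ (Fin 3)))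
        then p.1.reroot p.2 h else p.1 : RootedHardCoreConfig (EuclideanSpace ℝ (Fin 3)) δ), -p.2)) :=
    measurable_reroot hδ
  have hinvol := fun (p : RootedHardCoreConfig (EuclideanSpace ℝ (Fin 3)) δ × EuclideanSpace ℝ (Fin 3))
      (hp : p.2 ∈ ((p.1.1 : LocalConfig (EuclideanSpace ℝ (Fin 3))) : Set (EuclideanSpace ℝ (Fin 3)))) =>
    reroot_reroot_apply (δ := δ) p hp
  have hmem := ae_snd_mem_compProd (δ := δ) ν
  -- name the involution
  set Θ' : RootedHardCoreConfig (EuclideanSpace ℝ (Fin 3)) δ × EuclideanSpace ℝ (Fin 3) →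
      RootedHardCoreConfig (EuclideanSpace ℝ (Fin 3)) δ × EuclideanSpace ℝ (Fin 3) :=
    fun p => ((if h : p.2 ∈ ((p.1.1 : LocalConfig (EuclideanSpace ℝ (Fin 3))) : Set (EuclideanSpace ℝ (Fin 3)))
      then p.1.reroot p.2 h else p.1 : RootedHardCoreConfig (EuclideanSpace ℝ (Fin 3)) δ), -p.2) with hΘ'_def
  -- the two Campbell integrands
  set G : RootedHardCoreConfig (EuclideanSpace ℝ (Fin 3)) δ × EuclideanSpace ℝ (Fin 3) → ℝ≥0∞ :=
    fun p => g p.1 * (w p.2 * f (Θ' p).1) with hG_def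
  set G' : RootedHardCoreConfig (EuclideanSpace ℝ (Fin 3)) δ × EuclideanSpace ℝ (Fin 3) → ℝ≥0∞ :=
    fun p => f p.1 * (w p.2 * g (Θ' p).1) with hG'_def
  have hG : Measurable G :=
    (hg.comp measurable_fst).mul ((hw.comp measurable_snd).mul (hf.comp hΘ.fst))
  have hG' : Measurable G' :=
    (hf.comp measurable_fst).mul ((hw.comp measurable_snd).mul (hg.comp hΘ.fst))
  -- `G ∘ Θ = G'` on the incidence set
  have hcomp : ∀ᵐ p ∂(ν ⊗ₘ (⟨fun S : RootedHardCoreConfig (EuclideanSpace ℝ (Fin 3)) δ =>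
        (S.1 : LocalConfig (EuclideanSpace ℝ (Fin 3))).toMeasure,
        measurable_toMeasure (Fact.out : 0 < δ)⟩ :
        Kernel (RootedHardCoreConfig (EuclideanSpace ℝ (Fin 3)) δ) (EuclideanSpace ℝ (Fin 3)))),
      G (Θ' p) = G' p := by
    filter_upwards [hmem] with p hp
    have h1 : G (Θ' p) = g (Θ' p).1 * (w (Θ' p).2 * f (Θ' (Θ' p)).1) := rfl
    have h2 : (Θ' p).2 = -p.2 := rfl
    rw [h1, hinvol p hp, h2, hws]
    show g (Θ' p).1 * (w p.2 * f p.1) = f p.1 * (w p.2 * g (Θ' p).1)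
    ring
  -- both sides as Campbell integrals
  have hL : ∫⁻ S, g S * ∫⁻ y, w y * f (Θ' (S, y)).1
        ∂((S.1 : LocalConfig (EuclideanSpace ℝ (Fin 3))).toMeasure) ∂ν =
      ∫⁻ p, G p ∂(ν ⊗ₘ (⟨fun S : RootedHardCoreConfig (EuclideanSpace ℝ (Fin 3)) δ =>
        (S.1 : LocalConfig (EuclideanSpace ℝ (Fin 3))).toMeasure,
        measurable_toMeasure (Fact.out : 0 < δ)⟩ :
        Kernel (RootedHardCoreConfig (EuclideanSpace ℝ (Fin 3)) δ) (EuclideanSpace ℝ (Fin 3)))) := by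
    rw [Measure.lintegral_compProd hG]
    refine lintegral_congr fun S => ?_
    have hmeas : Measurable fun y : EuclideanSpace ℝ (Fin 3) => w y * f (Θ' (S, y)).1 :=
      hw.mul (hf.comp (hΘ.comp measurable_prodMk_left).fst)
    rw [← lintegral_const_mul (g S) hmeas]
    rfl
  have hR : ∫⁻ S, f S * ∫⁻ y, w y * g (Θ' (S, y)).1
        ∂((S.1 : LocalConfig (EuclideanSpace ℝ (Fin 3))).toMeasure) ∂ν =
      ∫⁻ p, G' p ∂(ν ⊗ₘ (⟨fun S : RootedHardCoreConfig (EuclideanSpace ℝ (Fin 3)) δ =>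
        (S.1 : LocalConfig (EuclideanSpace ℝ (Fin 3))).toMeasure,
        measurable_toMeasure (Fact.out : 0 < δ)⟩ :
        Kernel (RootedHardCoreConfig (EuclideanSpace ℝ (Fin 3)) δ) (EuclideanSpace ℝ (Fin 3)))) := by
    rw [Measure.lintegral_compProd hG']
    refine lintegral_congr fun S => ?_
    have hmeas : Measurable fun y : EuclideanSpace ℝ (Fin 3) => w y * g (Θ' (S, y)).1 :=
      hw.mul (hg.comp (hΘ.comp measurable_prodMk_left).fst)
    rw [← lintegral_const_mul (f S) hmeas]
    rfl
  rw [hL, hR, ← lintegral_congr_ae hcomp, ← lintegral_map hG hΘ, hinv]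

end Summit.AtomisticToContinuum.Crystallization.Theorems.FrustratedLawDichotomyErgodicReduction

end
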